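import Literature.NumberTheory.EllipticCurves.AnticyclotomicSignedSelmer
import Mathlib.Algebra.Module.CharacterModule
import HarnessLib

/-!
# The restriction maps `X^{𝓛′,Σ′} → X^{𝓛,Σ}` between Castella–Wan's anticyclotomic signed Selmer
# duals are `Λ^ac`-LINEAR and SURJECTIVE whenever `Sel^{𝓛,Σ} ≤ Sel^{𝓛′,Σ′}` (proved)

`Proofs`-style sequel of `Literature/NumberTheory/EllipticCurves/AnticyclotomicSignedSelmer.lean`
(utd-ty1 g0, p600108) and of `…AnticyclotomicSignedSelmerLocalOrderProofs.lean` (the inclusions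
`Sel^{str,±} ≤ Sel^{±,±} ≤ Sel^{±,rel}`, …). THEOREMS ONLY (no definition, no named fact, no `sorry`):

* §1 (generic, `IwasawaDual`) `IsLocNil.smulFun_comp_eq` / `module_smul_comp_eq` — for two `p`-primary groups `S, S′` with
  locally nilpotent endomorphisms `ψ, ψ′` and an additive map `j : S → S′` intertwining them, the
  precomposition `x ↦ x ∘ j : Hom(S′, A) → Hom(S, A)` commutes with the CONSTRUCTED `ℤ_p⟦T⟧`-actions
  `IsLocNil.module` (`(f • x) ∘ j = f • (x ∘ j)`): the truncated evaluation
  `∑ coeff_i(f) · x(ψ′^i (j s))` is `∑ coeff_i(f) · x(j (ψ^i s))`.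
* §2 for every elliptic curve over a number field, every `ℤ_p`-extension `κ` with generator `γ`, and
  every pair with `Sel^{𝓛,Σ} ≤ Sel^{𝓛′,Σ′}` (`h`): the restriction `x ↦ x ∘ incl` from
  `X^{𝓛′,Σ′} = Hom(Sel^{𝓛′,Σ′}, ℚ/ℤ)` to `X^{𝓛,Σ}` is `Λ^ac`-linear for the structures
  `X.moduleOfGen hγ` (`X.smulFun_comp_inclusion`; both `T`'s act as `conj_γ − 1`) and SURJECTIVE
  (`X.comp_inclusion_surjective`; `ℚ/ℤ` is divisible: Mathlib's
  `CharacterModule.dual_surjective_of_injective`), so `X^{𝓛,Σ}` is a `Λ^ac`-linear QUOTIENT of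
  `X^{𝓛′,Σ′}`; consequences `X.isTorsion_of_le` (torsion descends along the surjection) and
  `X.module_finite_of_le` (so does finite generation).

These are the discrete-side (`𝐀^ac`) maps "`X^{rel,str} ↠ X^{±,str}`", "`X^{rel,±} ↠ X^{±,±}`" of
Castella–Wan's (6.12)–(6.13) / (PT3)–(PT4), as honest `Λ^ac`-module maps between the constructed duals;
the EXACTNESS statements of those sequences (global duality) are not in this file. Banking for the
`⊇`-port of the BSD summit's crux `TwinSplitIMCAtThreeGoodSSApZero` (stmt-BirchSwinnertonDyer-23594;
width seat bsd-wall-utd-p2-w2). BSD is not advanced by this file.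

References: [CastellaWan2023] F. Castella, X. Wan, Math. Ann. 389 (2024), §4.2, Def. 5.1, (6.12)–(6.13);
[GreenbergLNM1716] R. Greenberg, LNM 1716 (1999), §1 p. 60 (the `Λ`-module structure on Pontryagin
duals); [Lang1990] S. Lang, *Cyclotomic Fields I and II*, Ch. 5 §1.
-/

open Literature.NumberTheory.EllipticCurves Literature.NumberTheory.GaloisRepresentations

universe u

noncomputable section

/-! ## §1 Precomposition with an intertwining map commutes with the `ℤ_p⟦T⟧`-actions -/

namespace Literature.NumberTheory.EllipticCurves.IwasawaDual.IsLocNil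

open scoped Classical
open Finset PowerSeries

variable {p : ℕ} [Fact p.Prime]
variable {S : Type*} [AddCommGroup S] {ψ : AddMonoid.End S}
variable {S' : Type*} [AddCommGroup S'] {ψ' : AddMonoid.End S'}
variable {A : Type*} [AddCommGroup A]

omit [Fact p.Prime] in
/-- An additive map intertwining `ψ` and `ψ′` intertwines their powers. [folklore] -/
private theorem apply_pow_apply_of_comm (j : S →+ S') (hj : ∀ s, j (ψ s) = ψ' (j s)) (i : ℕ) (s : S) :
    j ((ψ ^ i) s) = (ψ' ^ i) (j s) := by
  induction i generalizing s with
  | zero => simp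
  | succ i ih =>
    rw [pow_succ, pow_succ, AddMonoid.End.coe_mul, AddMonoid.End.coe_mul, Function.comp_apply,
      Function.comp_apply, ih, hj]

/-- **Precomposition with an intertwining map is `ℤ_p⟦T⟧`-linear for the constructed actions**: for
`h : IsLocNil p ψ` on `S`, `h′ : IsLocNil p ψ′` on `S′` and `j : S →+ S′` with `j ∘ ψ = ψ′ ∘ j`,
`f • (x ∘ j) = (f • x) ∘ j` for every `f ∈ ℤ_p⟦T⟧` and `x ∈ Hom(S′, A)`, the actions being
`h.smulFun` / `h′.smulFun` (= the scalar multiplications of `h.module` / `h′.module` definitionally,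
`module_smul_eq`): both sides are the truncated sums `∑_{i<N} coeff_i(f) · x(j(ψ^i s))` for admissible
`N, k` of `s` (`smulFun_apply`, `evalT_def`). Greenberg's "`Λ`-module structure on the Pontryagin
dual" is functorial in equivariant maps. [cite: GreenbergLNM1716, §1 p. 60 (after Conj. 1.3)] [cite: Lang1990, Ch. 5 §1] -/
theorem smulFun_comp_eq (h : IsLocNil p ψ) (h' : IsLocNil p ψ') (j : S →+ S')
    (hj : ∀ s, j (ψ s) = ψ' (j s)) (f : PowerSeries ℤ_[p]) (x : S' →+ A) :
    h.smulFun f (x.comp j) = (h'.smulFun f x).comp j := by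
  ext s
  rw [AddMonoidHom.comp_apply, h.smulFun_apply f (x.comp j) (h.tN_spec s) (h.tk_spec s)]
  have hN : (ψ' ^ h.tN s) (j s) = 0 := by
    rw [← apply_pow_apply_of_comm j hj, h.tN_spec, map_zero]
  have hk : p ^ h.tk s • j s = 0 := by
    rw [← map_nsmul, h.tk_spec, map_zero]
  rw [h'.smulFun_apply f x hN hk, evalT_def, evalT_def]
  refine Finset.sum_congr rfl fun i _ ↦ ?_
  rw [AddMonoidHom.comp_apply, apply_pow_apply_of_comm j hj]

/-- The same for the module structures: `f • (x ∘ j) = (f • x) ∘ j` under `h.module` on the left and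
`h′.module` on the right (`module_smul_eq`). [cite: GreenbergLNM1716, §1 p. 60 (after Conj. 1.3)] -/
theorem module_smul_comp_eq (h : IsLocNil p ψ) (h' : IsLocNil p ψ') (j : S →+ S')
    (hj : ∀ s, j (ψ s) = ψ' (j s)) (f : PowerSeries ℤ_[p]) (x : S' →+ A) :
    @HSMul.hSMul (PowerSeries ℤ_[p]) (S →+ A) (S →+ A) (@instHSMul _ _ (h.module (A := A)).toSMul)
        f (x.comp j) =
      (@HSMul.hSMul (PowerSeries ℤ_[p]) (S' →+ A) (S' →+ A)
        (@instHSMul _ _ (h'.module (A := A)).toSMul) f x).comp j :=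
  h.smulFun_comp_eq h' j hj f x

end Literature.NumberTheory.EllipticCurves.IwasawaDual.IsLocNil

/-! ## §2 The restriction maps between the signed Selmer duals -/

namespace Literature.NumberTheory.EllipticCurves.AcSigned

open scoped Classical
open NumberField IsDedekindDomain Field
open _root_.WeierstrassCurve

variable {K : Type u} [Field K] [NumberField K] (W : WeierstrassCurve K) (p : ℕ) [Fact p.Prime]
  (κ : ZpExtension K p) {S S' : Set (HeightOneSpectrum (𝓞 K))}
  {L L' : HeightOneSpectrum (𝓞 K) → PCond}

/-- The inclusion `Sel^{𝓛,Σ} ↪ Sel^{𝓛′,Σ′}` intertwines the two restrictions of `conj_γ`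
(both are `conj_γ` on `H¹(K_∞, E[p^∞])`). [cite: CastellaWan2023, §4.2 (MS p. 22), the `Λ^ac`-action] -/
theorem inclusion_conjSelmer_sub_one (h : selmer W p κ S L ≤ selmer W p κ S' L')
    (γ : absoluteGaloisGroup K) (s : selmer W p κ S L) :
    AddSubgroup.inclusion h ((conjSelmer W p κ S L γ - 1) s) =
      (conjSelmer W p κ S' L' γ - 1) (AddSubgroup.inclusion h s) := by
  apply Subtype.ext
  simp only [IwasawaDual.End_sub_apply, AddMonoid.End.one_apply, map_sub, AddSubgroup.coe_inclusion,
    AddSubgroupClass.coe_sub, coe_conjSelmer_apply]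

/-- **The restriction `X^{𝓛′,Σ′} → X^{𝓛,Σ}`, `x ↦ x ∘ incl`, is `Λ^ac`-linear** for the structures
`X.moduleOfGen hγ` on both sides (`Sel^{𝓛,Σ} ≤ Sel^{𝓛′,Σ′}`): `f • (x ∘ incl) = (f • x) ∘ incl`, stated
with the defining `smulFun`s of the two module structures (`X.moduleOfGen hγ = (isLocNil_…).module`,
whose `•` is `smulFun` definitionally, `IwasawaDual.IsLocNil.module_smul_eq`) —
`IsLocNil.smulFun_comp_eq` for the intertwining inclusion. E.g. the maps `X^{rel,str} → X^{±,str}`,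
`X^{rel,±} → X^{±,±}` of Castella–Wan (6.12)–(6.13) on the discrete side.
[cite: CastellaWan2023, (6.12)–(6.13) (MS p. 30)] [cite: GreenbergLNM1716, §1 p. 60] -/
theorem X.smulFun_comp_inclusion (h : selmer W p κ S L ≤ selmer W p κ S' L')
    {γ : absoluteGaloisGroup K} (hγ : κ.IsTopGenerator γ) (f : IwasawaAlgebra p) (x : X W p κ S' L') :
    (isLocNil_conjSelmer_sub_one W p κ S L hγ).smulFun f (x.comp (AddSubgroup.inclusion h)) =
      ((isLocNil_conjSelmer_sub_one W p κ S' L' hγ).smulFun f x).comp (AddSubgroup.inclusion h) :=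
  (isLocNil_conjSelmer_sub_one W p κ S L hγ).smulFun_comp_eq
    (isLocNil_conjSelmer_sub_one W p κ S' L' hγ) (AddSubgroup.inclusion h)
    (inclusion_conjSelmer_sub_one W p κ h γ) f x

/-- **The restriction `X^{𝓛′,Σ′} → X^{𝓛,Σ}` is surjective** (`Sel^{𝓛,Σ} ≤ Sel^{𝓛′,Σ′}`): every
character of the subgroup `Sel^{𝓛,Σ}` extends to `Sel^{𝓛′,Σ′}`, `ℚ/ℤ` being divisible (Mathlib's
`CharacterModule.dual_surjective_of_injective` for the injective inclusion). So `X^{𝓛,Σ}` is a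
`Λ^ac`-linear quotient of `X^{𝓛′,Σ′}` ("relaxing the local conditions" dually).
[cite: CastellaWan2023, Def. 5.1 (MS p. 23), "`X^{𝓛,Σ}` … relaxing the local conditions"] -/
theorem X.comp_inclusion_surjective (h : selmer W p κ S L ≤ selmer W p κ S' L') :
    Function.Surjective fun x : X W p κ S' L' ↦ x.comp (AddSubgroup.inclusion h) := by
  have hs := CharacterModule.dual_surjective_of_injective (R := ℤ)
    ((AddSubgroup.inclusion h).toIntLinearMap) (AddSubgroup.inclusion_injective h)
  intro y
  obtain ⟨x, hx⟩ := hs y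
  refine ⟨x, AddMonoidHom.ext fun s ↦ ?_⟩
  exact DFunLike.congr_fun hx s

/-- **Torsion descends**: if `X^{𝓛′,Σ′}` is a torsion `Λ^ac`-module then so is its quotient `X^{𝓛,Σ}`
(`Sel^{𝓛,Σ} ≤ Sel^{𝓛′,Σ′}`; for the structures `X.moduleOfGen hγ`): e.g. `X^{±,str}` is torsion
once `X^{rel,str}` is (Castella–Wan Lemma 5.9 / Thm. 6.8 bookkeeping, discrete side).
[cite: CastellaWan2023, Lemma 5.9 and (6.12) (MS pp. 26, 30)] -/
theorem X.isTorsion_of_le (h : selmer W p κ S L ≤ selmer W p κ S' L')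
    {γ : absoluteGaloisGroup K} (hγ : κ.IsTopGenerator γ)
    (hT : letI := X.moduleOfGen W p κ S' L' hγ; Module.IsTorsion (IwasawaAlgebra p) (X W p κ S' L')) :
    letI := X.moduleOfGen W p κ S L hγ
    Module.IsTorsion (IwasawaAlgebra p) (X W p κ S L) := by
  letI := X.moduleOfGen W p κ S L hγ
  intro y
  obtain ⟨x, rfl⟩ := X.comp_inclusion_surjective W p κ h y
  obtain ⟨a, ha⟩ := @hT x
  refine ⟨a, ?_⟩
  change (isLocNil_conjSelmer_sub_one W p κ S' L' hγ).smulFun (a : IwasawaAlgebra p) x = 0 at ha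
  change (isLocNil_conjSelmer_sub_one W p κ S L hγ).smulFun (a : IwasawaAlgebra p)
    (x.comp (AddSubgroup.inclusion h)) = 0
  rw [X.smulFun_comp_inclusion W p κ h hγ, ha, AddMonoidHom.zero_comp]

/-- **Finite generation descends**: if `X^{𝓛′,Σ′}` is finitely generated over `Λ^ac` then so is its
quotient `X^{𝓛,Σ}` (`Sel^{𝓛,Σ} ≤ Sel^{𝓛′,Σ′}`; structures `X.moduleOfGen hγ`; Mathlib
`Module.Finite.of_surjective` for the `Λ^ac`-linear restriction). (For finite `Σ` both are finitely
generated outright: `X.module_finite` of `…ModuleFiniteProofs`.) [cite: GreenbergLNM1716, §1 p. 60] -/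
theorem X.module_finite_of_le (h : selmer W p κ S L ≤ selmer W p κ S' L')
    {γ : absoluteGaloisGroup K} (hγ : κ.IsTopGenerator γ)
    (hF : letI := X.moduleOfGen W p κ S' L' hγ; Module.Finite (IwasawaAlgebra p) (X W p κ S' L')) :
    letI := X.moduleOfGen W p κ S L hγ
    Module.Finite (IwasawaAlgebra p) (X W p κ S L) := by
  letI iL : Module (IwasawaAlgebra p) (X W p κ S L) := X.moduleOfGen W p κ S L hγ
  letI iL' : Module (IwasawaAlgebra p) (X W p κ S' L') := X.moduleOfGen W p κ S' L' hγ
  let r : X W p κ S' L' →ₗ[IwasawaAlgebra p] X W p κ S L :=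
    { toFun := fun x ↦ x.comp (AddSubgroup.inclusion h)
      map_add' := fun x y ↦ by ext s; rfl
      map_smul' := fun f x ↦ by
        change ((isLocNil_conjSelmer_sub_one W p κ S' L' hγ).smulFun f x).comp
            (AddSubgroup.inclusion h) =
          (isLocNil_conjSelmer_sub_one W p κ S L hγ).smulFun f (x.comp (AddSubgroup.inclusion h))
        exact (X.smulFun_comp_inclusion W p κ h hγ f x).symm }
  haveI := hF
  exact Module.Finite.of_surjective r (X.comp_inclusion_surjective W p κ h)

end Literature.NumberTheory.EllipticCurves.AcSigned

end
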